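import Summits.ResolutionOfSingularities.ResolutionOfSingularities.Theorems.HilbertSamuelEliminationCampaignW42TangentConeGenerators
import Summits.ResolutionOfSingularities.ResolutionOfSingularities.Theorems.HilbertSamuelEliminationCampaignW42PermissibleNearEqualities
import Literature.RingTheory.MvPolynomial.HilbertFunctionPolynomialExtension
import Literature.AlgebraicGeometry.Resolution.Ridge
import HarnessLib

/-!
# [OURS · L1 W4.2] Hironaka–Grothendieck at a near point: the tangent cone ideal of `𝒪` in the generators `(y, c)`,
# `𝔫 = 𝔭 + (y)`, is the extension `I(c)·k[T, Y]` of the fibre-cone ideal of the permissible centre `𝔭 = (c)`; and the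
# ridge of the fibre cone embeds as `F(C_{X,D,x}) × 0 ⊆ F(C_x X)` (campaign s42, cell res-hironaka; informal crux
# `RidgeConfinement`, stmt-ResolutionOfSingularities-17845; `--supports`)

HONEST FRAMING. OURS (slot W4.2, prover res-L1-s42-pv-1, gen 3). Hironaka–Grothendieck (HIO Thm. (21.9)–(21.10), CJS (3.14)
"`gr_𝔫(𝒪) ≅ (gr_𝔭 𝒪 ⊗ k)[T_1, …, T_s]` for permissible `𝔭`") identifies the tangent cone `C_x(X)` with
`C_{X,D,x} × T_x(D)`. We prove the ideal-theoretic form needed by the route's ridge confinement, at a NEAR point (where the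
numerical identity `H⁽⁰⁾(𝒪) = H⁽ˢ⁾(gr_𝔭 𝒪 ⊗ k)` is supplied by `…PermissibleNearEqualities.lean`): for `(𝒪, 𝔫, k)`
noetherian local universally catenary, `𝔭 = (c_1, …, c_n)` permissible, `𝔫 = 𝔭 + (y_1, …, y_s)` with `s = dim 𝒪/𝔭`:

* `CampaignW42.coneExtend s I = I · k[T_1, …, T_s, Y_1, …, Y_n]` (new variables IN FRONT: `Y_i ↦ Y_{i+s}`, the tree's
  `rename Fin.succ` iterated) with **`hilbertFunQuot_coneExtend`: `H(k[T,Y]/I·k[T,Y]) = H(k[Y]/I)⁽ˢ⁾`** (the tree's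
  `hilbertFunQuot_map_rename_succ`, `s` times);
* `CampaignW42.frontAppend y c : Fin (n+s) → 𝒪` (the family `(y, c)`), `span_range_frontAppend`;
* `le_of_hilbertFunQuot_eq` — homogeneous ideals `I ⊆ J` with the same Hilbert function are equal;
* `coneExtend_fibreConeIdeal_le` — `I(c)·k[T,Y] ⊆ I(y,c)` (always), and
  **`fibreConeIdeal_frontAppend_eq_coneExtend_of_isNearRing`** — **`I(y, c) = I(c)·k[T, Y]`** at a near point
  (`I(y,c) = fibreConeIdeal (frontAppend y c)` = the tangent cone ideal of `𝒪` in the generators `(y,c)`,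
  `…TangentConeGenerators.lean`);
* `frontAppend_zero_mem_ridge_coneExtend` — `u ∈ F(V(I))(κ) ⟹ (0, u) ∈ F(V(I·k[T,Y]))(κ)`.

NOTHING here is a statement of H. Hironaka's manuscript [Hironaka2017]. AI review is weaker than expert review.
References (orientation only): M. Herrmann, S. Ikeda, U. Orbanz, *Equimultiplicity and Blowing up* (1988),
Thm. (21.9)–(21.10), Cor. (21.11); V. Cossart, U. Jannsen, S. Saito, LNM 2270 (2020), Lemma 2.27 (2), (3.14).
-/

noncomputable section

-- single-conjunct summit: the doubled namespace component `ResolutionOfSingularities` is mandated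
set_option linter.dupNamespace false

open IsLocalRing MvPolynomial Module
open Literature.RingTheory.HilbertSamuel Literature.RingTheory.MvPolynomial
open Literature.AlgebraicGeometry.Resolution

namespace Summit.ResolutionOfSingularities.ResolutionOfSingularities.Theorems

namespace CampaignW42

universe u

/-! ## Families `(y, c)` indexed by `Fin (n + s)` with `y` in front -/

section FrontAppend

variable {α : Type u} {n s : ℕ}

/-- [OURS · L1 W4.2] The family `(y_1, …, y_s, c_1, …, c_n)` indexed by `Fin (n + s)`: `k ↦ y_k` for `k < s`, `k ↦ c_{k-s}`
for `k ≥ s` (so that `c` sits at the positions `i + s = Fin.addNat i s`, matching `coneExtend`). NOT a statement of the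
manuscript. [folklore] -/
def frontAppend (y : Fin s → α) (c : Fin n → α) : Fin (n + s) → α :=
  fun k => if h : (k : ℕ) < s then y ⟨k, h⟩ else c ⟨(k : ℕ) - s, by omega⟩

/-- `frontAppend y c (i + s) = c_i`. [folklore] -/
@[simp] theorem frontAppend_addNat (y : Fin s → α) (c : Fin n → α) (i : Fin n) :
    frontAppend y c (i.addNat s) = c i := by
  unfold frontAppend
  have h : ¬ ((i.addNat s : Fin (n + s)) : ℕ) < s := by simp
  rw [dif_neg h]
  congr 1
  ext
  simp

/-- `frontAppend y c j = y_j` for `j < s`. [folklore] -/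
theorem frontAppend_of_lt (y : Fin s → α) (c : Fin n → α) (k : Fin (n + s)) (hk : (k : ℕ) < s) :
    frontAppend y c k = y ⟨k, hk⟩ := by
  unfold frontAppend
  rw [dif_pos hk]

/-- The values of `frontAppend y c` are those of `y` and of `c`. [folklore] -/
theorem range_frontAppend (y : Fin s → α) (c : Fin n → α) :
    Set.range (frontAppend y c) = Set.range y ∪ Set.range c := by
  ext a
  constructor
  · rintro ⟨k, rfl⟩
    unfold frontAppend
    split_ifs with h
    · exact Or.inl ⟨_, rfl⟩
    · exact Or.inr ⟨_, rfl⟩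
  · rintro (⟨j, rfl⟩ | ⟨i, rfl⟩)
    · refine ⟨⟨j, by omega⟩, ?_⟩
      rw [frontAppend_of_lt y c _ (by exact j.2)]
    · exact ⟨i.addNat s, frontAppend_addNat y c i⟩

/-- `span (y, c) = span y + span c`. [folklore] -/
theorem span_range_frontAppend {R : Type u} [CommRing R] (y : Fin s → R) (c : Fin n → R) :
    Ideal.span (Set.range (frontAppend y c)) = Ideal.span (Set.range y) ⊔ Ideal.span (Set.range c) := by
  rw [range_frontAppend, Ideal.span_union]

end FrontAppend

/-! ## The extension `I·k[T, Y]` and its Hilbert function -/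

section ConeExtend

variable {K : Type u} [Field K] {n : ℕ}

/-- [OURS · L1 W4.2] **`I · k[T_1, …, T_s, Y_1, …, Y_n]`**: the extension of `I ⊆ k[Y_1, …, Y_n]` to `s` new variables put
IN FRONT (`Y_i ↦` the variable of index `i + s`). NOT a statement of the manuscript. [folklore] -/
def coneExtend (s : ℕ) (I : Ideal (MvPolynomial (Fin n) K)) : Ideal (MvPolynomial (Fin (n + s)) K) :=
  I.map ((rename (fun i : Fin n => i.addNat s) : MvPolynomial (Fin n) K →ₐ[K] MvPolynomial (Fin (n + s)) K) :
    MvPolynomial (Fin n) K →+* MvPolynomial (Fin (n + s)) K)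

/-- No new variable: `coneExtend 0 I = I`. [folklore] -/
theorem coneExtend_zero (I : Ideal (MvPolynomial (Fin n) K)) : coneExtend 0 I = I := by
  have h : (fun i : Fin n => i.addNat 0) = id := funext fun i => Fin.ext (by simp)
  rw [coneExtend, h, rename_id]
  exact Ideal.map_id I

/-- One more variable: `coneExtend (s+1) I = (coneExtend s I)·k[T_0, …]` via `rename Fin.succ`. [folklore] -/
theorem coneExtend_succ (s : ℕ) (I : Ideal (MvPolynomial (Fin n) K)) :
    coneExtend (s + 1) I = (coneExtend s I).map
      ((rename Fin.succ : MvPolynomial (Fin (n + s)) K →ₐ[K] MvPolynomial (Fin (n + s + 1)) K) :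
        MvPolynomial (Fin (n + s)) K →+* MvPolynomial (Fin (n + s + 1)) K) := by
  rw [coneExtend, coneExtend, Ideal.map_map]
  congr 1
  have h : (Fin.succ ∘ fun i : Fin n => i.addNat s) = fun i : Fin n => i.addNat (s + 1) :=
    funext fun i => Fin.ext (by simp; omega)
  refine RingHom.ext fun p => ?_
  change rename (fun i : Fin n => i.addNat (s + 1)) p = rename Fin.succ (rename (fun i : Fin n => i.addNat s) p)
  rw [rename_rename, h]

/-- **`H(k[T,Y]/I·k[T,Y]) = H(k[Y]/I)⁽ˢ⁾`**: each new free variable replaces the Hilbert function by its sum function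
(the tree's `hilbertFunQuot_map_rename_succ`, CJS Lemma 2.27 (2)). [cite: CossartJannsenSaito2020, Lemma 2.27 (2)] -/
theorem hilbertFunQuot_coneExtend (s : ℕ) (I : Ideal (MvPolynomial (Fin n) K)) :
    hilbertFunQuot K (n + s) (coneExtend s I) = iterPSum s (hilbertFunQuot K n I) := by
  induction s with
  | zero => rw [coneExtend_zero]; rfl
  | succ s ih =>
    funext d
    rw [iterPSum_succ, psum_apply, ← ih, coneExtend_succ]
    exact hilbertFunQuot_map_rename_succ (coneExtend s I) d

/-- **Homogeneous ideals `I ⊆ J` with the same Hilbert function coincide.** [folklore] -/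
theorem le_of_hilbertFunQuot_eq {m : ℕ} {I J : Ideal (MvPolynomial (Fin m) K)} (hJ : IsHomogeneousIdeal J) (hIJ : I ≤ J)
    (h : hilbertFunQuot K m I = hilbertFunQuot K m J) : J ≤ I := by
  classical
  intro g hg
  rw [← sum_homogeneousComponent g]
  refine Ideal.sum_mem _ fun d _ => ?_
  -- `I_d = J_d` (inclusion with equal dimension)
  have hle : idealDegree I d ≤ idealDegree J d := fun f hf => ⟨hIJ hf.1, hf.2⟩
  have hJd : idealDegree J d ≤ homogeneousSubmodule (Fin m) K d := fun f hf => (mem_idealDegree.mp hf).2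
  haveI : Module.Finite K (homogeneousSubmodule (Fin m) K d) :=
    Literature.RingTheory.MvPolynomial.finite_homogeneousSubmodule d
  haveI : FiniteDimensional K (idealDegree J d) := Submodule.finiteDimensional_of_le hJd
  have hfin : finrank K (idealDegree I d) = finrank K (idealDegree J d) := by
    have hd := congr_fun h d
    unfold hilbertFunQuot at hd
    have h1 := finrank_idealDegree_le I d
    have h2 := finrank_idealDegree_le J d
    omega
  have heq := Submodule.eq_of_le_of_finrank_eq hle hfin
  have hgd : homogeneousComponent d g ∈ idealDegree J d :=
    mem_idealDegree.mpr ⟨hJ g hg d, homogeneousComponent_isHomogeneous d g⟩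
  rw [← heq] at hgd
  exact (mem_idealDegree.mp hgd).1

/-! ### The ridge of `V(I)` embeds in the ridge of `V(I·k[T,Y])` -/

variable {κ : Type u} [CommRing κ] [Algebra K κ]

/-- `coneIdeal κ` commutes with `coneExtend`. [folklore] -/
theorem coneIdeal_coneExtend (s : ℕ) (I : Ideal (MvPolynomial (Fin n) K)) :
    coneIdeal κ (coneExtend s I) = (coneIdeal κ I).map
      ((rename (fun i : Fin n => i.addNat s) : MvPolynomial (Fin n) κ →ₐ[κ] MvPolynomial (Fin (n + s)) κ) :
        MvPolynomial (Fin n) κ →+* MvPolynomial (Fin (n + s)) κ) := by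
  rw [coneIdeal, coneIdeal, coneExtend, Ideal.map_map, Ideal.map_map]
  congr 1
  refine RingHom.ext fun p => ?_
  change MvPolynomial.map (algebraMap K κ) (rename (fun i : Fin n => i.addNat s) p) =
    rename (fun i : Fin n => i.addNat s) (MvPolynomial.map (algebraMap K κ) p)
  rw [map_rename]

/-- Translation by `(0, u)` and the embedding `Y_i ↦ Y_{i+s}`: `shift_{(0,u)} ∘ rename = rename ∘ shift_u`. [folklore] -/
theorem shift_frontAppend_rename (s : ℕ) (u : Fin n → κ) (g : MvPolynomial (Fin n) κ) :
    shift (frontAppend (0 : Fin s → κ) u) (rename (fun i : Fin n => i.addNat s) g) =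
      rename (fun i : Fin n => i.addNat s) (shift u g) := by
  rw [← AlgHom.comp_apply, ← AlgHom.comp_apply]
  congr 1
  refine MvPolynomial.algHom_ext fun i => ?_
  rw [AlgHom.comp_apply, AlgHom.comp_apply, rename_X, shift_X, shift_X, map_add, rename_X, frontAppend_addNat]
  congr 1
  exact (rename_C _ _).symm

/-- **`u ∈ F(V(I))(κ) ⟹ (0, u) ∈ F(V(I·k[T,Y]))(κ)`**: the ridge of a cone embeds (with zero `T`-coordinates) in the ridge
of the product cone. [cite: Giraud1975, §1.5] -/
theorem frontAppend_zero_mem_ridge_coneExtend (s : ℕ) {I : Ideal (MvPolynomial (Fin n) K)} {u : Fin n → κ}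
    (hu : u ∈ ridge κ I) : frontAppend (0 : Fin s → κ) u ∈ ridge κ (coneExtend s I) := by
  rw [mem_ridge_iff, coneIdeal_coneExtend]
  intro f hf
  have hle : (coneIdeal κ I).map
      ((rename (fun i : Fin n => i.addNat s) : MvPolynomial (Fin n) κ →ₐ[κ] MvPolynomial (Fin (n + s)) κ) :
        MvPolynomial (Fin n) κ →+* MvPolynomial (Fin (n + s)) κ) ≤
      ((coneIdeal κ I).map ((rename (fun i : Fin n => i.addNat s) : MvPolynomial (Fin n) κ →ₐ[κ]
        MvPolynomial (Fin (n + s)) κ) : MvPolynomial (Fin n) κ →+* MvPolynomial (Fin (n + s)) κ)).comap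
        ((shift (frontAppend (0 : Fin s → κ) u) : MvPolynomial (Fin (n + s)) κ →ₐ[κ] MvPolynomial (Fin (n + s)) κ) :
          MvPolynomial (Fin (n + s)) κ →+* MvPolynomial (Fin (n + s)) κ) := by
    rw [Ideal.map_le_iff_le_comap]
    intro g hg
    rw [Ideal.mem_comap, Ideal.mem_comap]
    change shift (frontAppend (0 : Fin s → κ) u) (rename (fun i : Fin n => i.addNat s) g) ∈ _
    rw [shift_frontAppend_rename]
    exact Ideal.mem_map_of_mem _ (mem_ridge_iff.mp hu g hg)
  exact hle hf

end ConeExtend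

/-! ## Hironaka–Grothendieck at a near point -/

section Permissible

variable {O : Type u} [CommRing O] [IsLocalRing O] {n s : ℕ} (c : Fin n → O) (y : Fin s → O)

local notation3 "𝔭" => Ideal.span (Set.range c)

/-- **`I(c)·k[T,Y] ⊆ I(y,c)`** (always): a form `G(Y)` with `G(c) ∈ 𝔫𝔭ᵈ` has `G(c) ∈ 𝔫·(y,c)ᵈ`. [folklore] -/
theorem coneExtend_fibreConeIdeal_le : coneExtend s (fibreConeIdeal c) ≤ fibreConeIdeal (frontAppend y c) := by
  classical
  rw [coneExtend, Ideal.map_le_iff_le_comap]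
  intro g hg
  rw [Ideal.mem_comap]
  change rename (fun i : Fin n => i.addNat s) g ∈ fibreConeIdeal (frontAppend y c)
  rw [← sum_homogeneousComponent g, map_sum]
  refine Ideal.sum_mem _ fun d _ => ?_
  have hgd := isHomogeneousIdeal_fibreConeIdeal c g hg d
  obtain ⟨G, hG, hGg⟩ := exists_isHomogeneous_map_residue_eq (homogeneousComponent_isHomogeneous d g)
  rw [← hGg] at hgd ⊢
  have hev := (map_residue_mem_fibreConeIdeal_iff c hG).mp hgd
  rw [← map_rename]
  refine (map_residue_mem_fibreConeIdeal_iff (frontAppend y c) (hG.rename_isHomogeneous)).mpr ?_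
  rw [eval_rename]
  have hcomp : (frontAppend y c ∘ fun i : Fin n => i.addNat s) = c := funext fun i => frontAppend_addNat y c i
  rw [hcomp]
  refine Ideal.mul_mono_right (Ideal.pow_right_mono ?_ d) hev
  exact Ideal.span_mono (by rw [range_frontAppend]; exact Set.subset_union_right)

variable [IsNoetherianRing O] (j : Fin n)

local notation3 "hcj" => Ideal.mem_span_range_self (f := c) (x := j)

variable (P : Ideal (chartRing c j)) [P.IsPrime]
variable (O' : Type u) [CommRing O'] [Algebra (chartRing c j) O'] [IsLocalization.AtPrime O' P]
  [IsLocalRing O'] [Algebra O O']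

/-- **Hironaka–Grothendieck at a near point: `I(y, c) = I(c)·k[T, Y]`.** For `𝔭 = (c)` permissible,
`𝔫 = 𝔭 + (y_1, …, y_s)` with `s = dim 𝒪/𝔭`, and a NEAR point of the blow-up along `𝔭` (supplying
`H⁽⁰⁾(𝒪) = H⁽ˢ⁾(gr_𝔭 𝒪 ⊗ k)`): the tangent cone ideal of `𝒪` in the generators `(y, c)` is the extension of the fibre
cone ideal of `𝔭`. [cite: HerrmannIkedaOrbanz1988, Thm. (21.10)] -/
theorem fibreConeIdeal_frontAppend_eq_coneExtend_of_isNearRing (hO : IsUniversallyCatenaryRing O) [(𝔭).IsPrime]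
    [IsRegularLocalRing (O ⧸ 𝔭)] (hs : ringKrullDim (O ⧸ 𝔭) = s) (hNF : (𝔭).IsNormallyFlat)
    (hy : maximalIdeal O = (𝔭) ⊔ Ideal.span (Set.range y))
    (hP : P.comap (chartBase c j) = maximalIdeal O)
    (hOO' : ∀ r : O, algebraMap O O' r = (algebraMap (chartRing c j) O' : chartRing c j →+* O') (chartBase c j r))
    {N : ℕ} (hnear : IsNearRing O O' N) :
    fibreConeIdeal (frontAppend y c) = coneExtend s (fibreConeIdeal c) := by
  have hc' : Ideal.span (Set.range (frontAppend y c)) = maximalIdeal O := by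
    rw [span_range_frontAppend, sup_comm, ← hy]
  refine le_antisymm (le_of_hilbertFunQuot_eq (isHomogeneousIdeal_fibreConeIdeal _)
    (coneExtend_fibreConeIdeal_le c y) ?_) (coneExtend_fibreConeIdeal_le c y)
  -- `H(k[T,Y]/I(c)k[T,Y]) = H(k[Y]/I(c))⁽ˢ⁾ = H⁽ˢ⁾(FibreConeLocal 𝔭) = H⁽⁰⁾(𝒪) = H(k[T,Y]/I(y,c))`
  rw [hilbertFunQuot_coneExtend, hilbertFunQuot_fibreConeIdeal_eq_hilbertFun (frontAppend y c) hc',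
    ← hilbertFun_fibreConeLocal_eq_hilbertFunQuot c]
  have h := hilbertSamuelFun_fibreConeLocal_eq_of_isNearRing c j P O' hO hs hNF hP hOO' hnear 0
  rw [zero_add] at h
  exact h

end Permissible

end CampaignW42

end Summit.ResolutionOfSingularities.ResolutionOfSingularities.Theorems

end
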